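import Summits.MatrixMultiplication.MatrixMultiplication.Theorems.SoloInformedFibreLines

/-!
# Witness exclusion: the class-level form of separation — for EVERY host

This work, §8.7 (o). Setting of `SoloInformedFibreLines` (CohnUmans2013, arXiv:1207.6528, Def. 12, in
the coprime case with one involutory multiplier: twisted data `a, b, c : [n]² → S¹` with the triangle
equations (E) on every triple, and separation (Sep) of the ordered pairs of distinct triples lying in one
fibre of the flat chart).

Admissibility of a value triple `(x, v, w)` — some sign pattern solves `x ± v ± w = 0` — depends only
on the SIGN CLASSES `{±x}, {±v}, {±w}` (`Adm.of_signEq_left/mid/right`). Consequently separation of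
the ordered pair `τ = (i,j,k) → τ' = (i',j',k')` (mixed cells `a(i,j)`, `b(j',k)`, `c(k',i')`) is
refuted by any own triple that shares ONE of the three mixed cells and reproduces the classes of the
other two:

* `Data.witness_b`: no row index `i''` has `a(i'',j') ~ a(i,j)` and `c(k,i'') ~ c(k',i')`
  (the own triples `(i'',j',k)` of the cross cell `b(j',k)`);
* `Data.witness_a`: no `k''` has `b(j,k'') ~ b(j',k)` and `c(k'',i) ~ c(k',i')` (own triples of `a(i,j)`);
* `Data.witness_c`: no `j''` has `a(i',j'') ~ a(i,j)` and `b(j'',k') ~ b(j',k)` (own triples of `c(k',i')`),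

where `~` is equality of sign classes (`SignEq`). The three PLANE LEMMAS of `SoloInformedFibrePlanes`
(`kPlane_class_ne`, `jPlane_class_ne`, `iPlane_class_ne`, hence LEMMA Z and the pair-counting reduction
of §8.7 (m)) are the degenerate witnesses `i'' ∈ {i, i'}`, `k'' = k'` (`kPlane_not_signEq`,
`jPlane_not_signEq`, `iPlane_not_signEq` below); the general witness is the arithmetic-free part of (Sep):
in terms of the CLASS MATRICES `A = [a]`, `B = [b]`, `C = [c]`, a same-fibre ordered pair `(τ, τ')` must
have `([a(τ)], [c(τ')])` outside the set of class pairs `{([a(i'',j')], [c(k,i'')]) : i''}` co-occurring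
on column `j'` of `A` and row `k` of `C` (and two rotated statements). Data whose class matrices are
'pattern-rich' therefore separate nothing (`not_sep_of_witness`): cheap hosts need ALIGNED class
matrices, the structure exploited for `S¹ = ℤ/3` in `SoloInformedTinyHostFibres` (Theorem 8.11).
Also recorded: inside one fibre, two triples with the same `c`-class have their cross cell `b(j',k)`
NON-admissible against the own pair `a(i,j), c(k,i)` while the own cell `b(j,k)` is admissible — the
'induced matching' form of a fibre piece (`cross_not_adm_of_signEq_c`), §8.7 (f′).
References: this work §8.7 (l), (m), (o); CohnUmans2013 Def. 12.
-/

namespace Summit.MatrixMultiplication.MatrixMultiplication.Theorems.TwistedTPP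

namespace FibreLines

variable {ι G : Type*} [AddCommGroup G]

/-- Same sign class: `x = y` or `x = -y`. [this work, §8.7 (o)] -/
def SignEq (x y : G) : Prop := x = y ∨ x = -y

/-- `~` is reflexive. -/
theorem SignEq.refl (x : G) : SignEq x x := Or.inl rfl

/-- `~` is symmetric. -/
theorem SignEq.symm {x y : G} (h : SignEq x y) : SignEq y x := by
  rcases h with h | h
  · exact Or.inl h.symm
  · exact Or.inr (by rw [h, neg_neg])

/-- Admissibility of a value triple: some sign pattern solves `x ± v ± w = 0` (the shape of the triangle
equation (E) in `FibreLines.Data.eqn`). [this work, §8.3] -/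
def Adm (x v w : G) : Prop :=
  x + v + w = 0 ∨ x + v - w = 0 ∨ x - v + w = 0 ∨ x - v - w = 0

/-- Negating the first entry permutes the four sign patterns. [this work, §8.7 (o)] -/
theorem Adm.of_neg_left {x v w : G} (h : Adm (-x) v w) : Adm x v w := by
  rcases h with h | h | h | h
  · right; right; right
    have e : x - v - w = -(-x + v + w) := by abel
    rw [e, h, neg_zero]
  · right; right; left
    have e : x - v + w = -(-x + v - w) := by abel
    rw [e, h, neg_zero]
  · right; left
    have e : x + v - w = -(-x - v + w) := by abel
    rw [e, h, neg_zero]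
  · left
    have e : x + v + w = -(-x - v - w) := by abel
    rw [e, h, neg_zero]

/-- Negating the middle entry permutes the four sign patterns. [this work, §8.7 (o)] -/
theorem Adm.of_neg_mid {x v w : G} (h : Adm x (-v) w) : Adm x v w := by
  rcases h with h | h | h | h
  · right; right; left
    have e : x - v + w = x + -v + w := by abel
    rw [e, h]
  · right; right; right
    have e : x - v - w = x + -v - w := by abel
    rw [e, h]
  · left
    have e : x + v + w = x - -v + w := by abel
    rw [e, h]
  · right; left
    have e : x + v - w = x - -v - w := by abel
    rw [e, h]

/-- Negating the last entry permutes the four sign patterns. [this work, §8.7 (o)] -/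
theorem Adm.of_neg_right {x v w : G} (h : Adm x v (-w)) : Adm x v w := by
  rcases h with h | h | h | h
  · right; left
    have e : x + v - w = x + v + -w := by abel
    rw [e, h]
  · left
    have e : x + v + w = x + v - -w := by abel
    rw [e, h]
  · right; right; right
    have e : x - v - w = x - v + -w := by abel
    rw [e, h]
  · right; right; left
    have e : x - v + w = x - v - -w := by abel
    rw [e, h]

/-- Admissibility is a property of the sign class of the first entry. [this work, §8.7 (o)] -/
theorem Adm.of_signEq_left {x x' v w : G} (h : Adm x' v w) (hx : SignEq x' x) : Adm x v w := by
  rcases hx with rfl | rfl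
  · exact h
  · exact Adm.of_neg_left h

/-- … of the middle entry. [this work, §8.7 (o)] -/
theorem Adm.of_signEq_mid {x v v' w : G} (h : Adm x v' w) (hv : SignEq v' v) : Adm x v w := by
  rcases hv with rfl | rfl
  · exact h
  · exact Adm.of_neg_mid h

/-- … and of the last entry. [this work, §8.7 (o)] -/
theorem Adm.of_signEq_right {x v w w' : G} (h : Adm x v w') (hw : SignEq w' w) : Adm x v w := by
  rcases hw with rfl | rfl
  · exact h
  · exact Adm.of_neg_right h

/-- (E) says every own triple is admissible. -/
theorem Data.adm_eqn (D : Data ι G) (i j k : ι) : Adm (D.a i j) (D.b j k) (D.c k i) :=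
  D.eqn i j k

/-- (Sep) says the mixed triple is not admissible. -/
theorem Data.sep_iff_not_adm (D : Data ι G) (i j k i' j' k' : ι) :
    D.Sep i j k i' j' k' ↔ ¬ Adm (D.a i j) (D.b j' k) (D.c k' i') := by
  simp only [Data.Sep, Adm, ne_eq, not_or]

/-- **Witness exclusion on the cross cell.** If `(i,j,k) → (i',j',k')` is separated then no own triple
`(i'',j',k)` of the cross cell `b(j',k)` reproduces the classes of `a(i,j)` and `c(k',i')`: there is no
`i''` with `a(i'',j') ~ a(i,j)` and `c(k,i'') ~ c(k',i')`. [this work, §8.7 (o)] -/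
theorem Data.witness_b (D : Data ι G) {i j k i' j' k' : ι} (h : D.Sep i j k i' j' k') (i'' : ι) :
    ¬ (SignEq (D.a i'' j') (D.a i j) ∧ SignEq (D.c k i'') (D.c k' i')) := by
  rintro ⟨ha, hc⟩
  exact (D.sep_iff_not_adm i j k i' j' k').mp h
    (((D.adm_eqn i'' j' k).of_signEq_left ha).of_signEq_right hc)

/-- **Witness exclusion on the own `a`-cell.** If `(i,j,k) → (i',j',k')` is separated then no own triple
`(i,j,k'')` of `a(i,j)` has `b(j,k'') ~ b(j',k)` and `c(k'',i) ~ c(k',i')`. [this work, §8.7 (o)] -/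
theorem Data.witness_a (D : Data ι G) {i j k i' j' k' : ι} (h : D.Sep i j k i' j' k') (k'' : ι) :
    ¬ (SignEq (D.b j k'') (D.b j' k) ∧ SignEq (D.c k'' i) (D.c k' i')) := by
  rintro ⟨hb, hc⟩
  exact (D.sep_iff_not_adm i j k i' j' k').mp h
    (((D.adm_eqn i j k'').of_signEq_mid hb).of_signEq_right hc)

/-- **Witness exclusion on the own `c`-cell.** If `(i,j,k) → (i',j',k')` is separated then no own triple
`(i',j'',k')` of `c(k',i')` has `a(i',j'') ~ a(i,j)` and `b(j'',k') ~ b(j',k)`. [this work, §8.7 (o)] -/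
theorem Data.witness_c (D : Data ι G) {i j k i' j' k' : ι} (h : D.Sep i j k i' j' k') (j'' : ι) :
    ¬ (SignEq (D.a i' j'') (D.a i j) ∧ SignEq (D.b j'' k') (D.b j' k)) := by
  rintro ⟨ha, hb⟩
  exact (D.sep_iff_not_adm i j k i' j' k').mp h
    (((D.adm_eqn i' j'' k').of_signEq_left ha).of_signEq_mid hb)

/-- Contrapositive packaging: a co-occurrence of the class pair `([a(i,j)], [c(k',i')])` on column `j'`
of `a` and row `k` of `c` forbids the separation `(i,j,k) → (i',j',k')`; if the column/row pair shows
every class pair, no triple of the `k`-plane `k` is separated from any triple of the `j`-plane `j'` and the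
two planes share no fibre. [this work, §8.7 (o)] -/
theorem Data.not_sep_of_witness (D : Data ι G) {i j k i' j' k' i'' : ι}
    (ha : SignEq (D.a i'' j') (D.a i j)) (hc : SignEq (D.c k i'') (D.c k' i')) :
    ¬ D.Sep i j k i' j' k' :=
  fun h => D.witness_b h i'' ⟨ha, hc⟩

/-- The `k`-plane lemma (`kPlane_class_ne` of `SoloInformedFibrePlanes`) is the witness `i'' = i'`:
for `k' = k`, `a(i',j') ≁ a(i,j)`. [this work, §8.7 (l), (o)] -/
theorem Data.kPlane_not_signEq (D : Data ι G) {i j k i' j' : ι} (h : D.Sep i j k i' j' k) :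
    ¬ SignEq (D.a i' j') (D.a i j) :=
  fun ha => D.witness_b h i' ⟨ha, SignEq.refl _⟩

/-- The `j`-plane lemma is the witness `i'' = i`: for `j' = j`, `c(k,i) ≁ c(k',i')`.
[this work, §8.7 (l), (o)] -/
theorem Data.jPlane_not_signEq (D : Data ι G) {i j k i' k' : ι} (h : D.Sep i j k i' j k') :
    ¬ SignEq (D.c k i) (D.c k' i') :=
  fun hc => D.witness_b h i ⟨SignEq.refl _, hc⟩

/-- The `i`-plane (anti-diagonal) lemma is the witness `k'' = k'` on the own `a`-cell: for `i' = i`,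
`b(j,k') ≁ b(j',k)`. [this work, §8.7 (l), (o)] -/
theorem Data.iPlane_not_signEq (D : Data ι G) {i j k j' k' : ι} (h : D.Sep i j k i j' k') :
    ¬ SignEq (D.b j k') (D.b j' k) :=
  fun hb => D.witness_a h k' ⟨hb, SignEq.refl _⟩

/-- **Induced-matching form of a fibre piece.** If `(i,j,k) → (i',j',k')` is separated and the own
`c`-cells have the same class, `c(k',i') ~ c(k,i)`, then the CROSS cell `b(j',k)` is not admissible
against the own pair `a(i,j), c(k,i)` — while the own cell `b(j,k)` is (`Data.adm_eqn`). So the triples of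
one fibre with fixed outer classes `([a], [c]) = (A, C)` project to an induced matching of the bipartite
graph `{(j,k) : Adm(a₀, b(j,k), c₀)}` (`a₀ ∈ A`, `c₀ ∈ C`). [this work, §8.7 (f′), (o)] -/
theorem Data.cross_not_adm_of_signEq_c (D : Data ι G) {i j k i' j' k' : ι} (h : D.Sep i j k i' j' k')
    (hc : SignEq (D.c k i) (D.c k' i')) : ¬ Adm (D.a i j) (D.b j' k) (D.c k i) :=
  fun hadm => (D.sep_iff_not_adm i j k i' j' k').mp h (hadm.of_signEq_right hc)

/-- Symmetric form: with equal `a`-classes `a(i',j') ~ a(i,j)`, the cross cell `b(j',k)` is not admissible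
against the own pair `a(i',j'), c(k',i')` of `τ'`. [this work, §8.7 (f′), (o)] -/
theorem Data.cross_not_adm_of_signEq_a (D : Data ι G) {i j k i' j' k' : ι} (h : D.Sep i j k i' j' k')
    (ha : SignEq (D.a i' j') (D.a i j)) : ¬ Adm (D.a i' j') (D.b j' k) (D.c k' i') :=
  fun hadm => (D.sep_iff_not_adm i j k i' j' k').mp h (hadm.of_signEq_left ha)

end FibreLines

end Summit.MatrixMultiplication.MatrixMultiplication.Theorems.TwistedTPP
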